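import Literature.Computability.Complexity.ShamirArithmetization
import Literature.Computability.Complexity.ArthurMerlinParallelPlay
import Literature.Computability.Complexity.BoolEncodings
import HarnessLib

/-!
# Shamir's protocol for `TQBF`, II: the referee, as arithmetic on strings (specification)

The public-coin interactive proof for `TQBF` (Shamir 1992 / Shen 1992; Arora–Barak 2009, §8.3.3)
is played in the tree as an Arthur–Merlin game with polynomially many moves
(`ArthurMerlinGames.lean`: all moves are bit strings of one length `M(|x|)`, Arthur's are
uniformly random, a deterministic polynomial-time referee decides at the end). This file fixes
the REFEREE as a function of the input formula and the list of moves, at the level of natural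
numbers and bit strings — the common specification of the value analysis
(`ShamirProtocolValues.lean`: soundness and completeness as game values, over `ZMod p`) and of
the polynomial-time referee (`ShamirRefereeMachine*.lean`, in the `FP` brick algebra), which is
proved to compute exactly these functions.

Protocol (input `x = encode ψ`, `ψ = Q₀X₀ ⋯ Q_{n-1}X_{n-1} φ` closed, `N = |x|`; parameters
`D = N + 2` (degree bound, `≥ max(2, |φ|)`), `B = 4N + 8` (challenge bits), `W = B + 1` (bits per
field element), `M = (D + 1) W` (move length)):

* moves `h = [a₀, y₀, a₂, y₁, a₁', y₂, a₂', …]` alternate Arthur/Merlin, Arthur first; `a₀`, `a₂`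
  are ignored; Merlin's `y₀` carries the PRIME `p = ⟦y₀ ↾ W⟧` (accepted only if `p` is prime and
  `2^B < p`, so `p < 2^W`); then one pair of moves per operator of the expression
  `opsOf n quants 0` (`ShamirArithmetization.lean`: `Q_{X_i}` followed by `L_{X_0} ⋯ L_{X_{n-1}}`,
  for `i = 0, …, n-1`; `T = n(n+1)` operators): Merlin's `y` is a univariate polynomial `s` of
  degree `≤ D`, coefficient `k` being the number `⟦block W k y⟧ < 2^W` (`coeff`, value `pv` mod
  `p`), and Arthur's reply `a` is the challenge `r = ⟦a ↾ B⟧ < 2^B < p` (`chal`);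
* the referee keeps the point `ρ ∈ 𝔽_p^n` (initially `0`), the claim `c` (initially `1`:
  "`ψ` is true") and a flag; at the operator `O` on the variable `X_v` it checks
  `O.test(ρ_v, s(0), s(1)) = c` (`testVal`: product for `∀`, `s(0) + s(1) - s(0)s(1)` for `∃`,
  `(1 - ρ_v) s(0) + ρ_v s(1)` for `L`), then sets `ρ_v := r`, `c := s(r)` (`step`, iterated by
  `run`); at the end it accepts iff `p` was a valid prime, every check passed, and
  `P_φ(ρ) = c` (`arithNat`, the arithmetization mod `p`; `Accepts`).

Everything is stated with total operations on `ℕ` and `List Bool` (`%`, truncated `-`, `getD`,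
`headD`), exactly as the machine computes it; the bridge to `ZMod p` is in the values file.

## References

* A. Shamir, *IP = PSPACE*, J. ACM 39 (1992) 869–877 [Shamir1992].
* A. Shen, *IP = PSPACE: simplified proof*, J. ACM 39 (1992) 878–880 [Shen1992].
* S. Arora, B. Barak, *Computational Complexity: A Modern Approach*, CUP 2009, §8.3.3 (protocol
  for `TQBF`, Cases 1–3), §8.2.1 (public coins).
-/

namespace Literature.Computability.Complexity

namespace Shamir

open Finset

/-! ### Parameters -/

/-- The degree bound `D = N + 2` on Merlin's polynomials (at least `max(2, |φ|)` since
`|φ| ≤ |code φ| ≤ N`). [cite: AroraBarakCC2009, §8.3.3 ("d an upper bound known to the verifier")] -/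
def degD (N : ℕ) : ℕ := N + 2

/-- The number `B = 4N + 8` of random bits of a challenge (soundness error `T·D/2^B ≤ 1/3`).
[cite: AroraBarakCC2009, §8.3.3] -/
def bitsB (N : ℕ) : ℕ := 4 * N + 8

/-- The width `W = B + 1` of a field element (`2^B < p < 2^W`). [cite: AroraBarakCC2009, §8.3.3] -/
def widthW (N : ℕ) : ℕ := bitsB N + 1

/-- The common move length `M = (D + 1) · W` (room for `D + 1` coefficients).
[cite: AroraBarakCC2009, §8.3.3] -/
def moveLen (N : ℕ) : ℕ := (degD N + 1) * widthW N

/-! ### Reading the moves -/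

/-- Coefficient `k` of Merlin's polynomial: the number written in block `k` (width `W`) of his
move. [cite: AroraBarakCC2009, §8.3.3 ("the prover provides a degree d polynomial s")] -/
def coeff (N : ℕ) (y : List Bool) (k : ℕ) : ℕ := bitsToNat (block (widthW N) k y)

/-- **The value `s(a) mod p` of Merlin's polynomial** `s = ∑_{k ≤ D} coeff_k X^k` at `a`.
[cite: AroraBarakCC2009, §8.3.3] -/
def pv (N p : ℕ) (y : List Bool) (a : ℕ) : ℕ :=
  (∑ k ∈ range (degD N + 1), coeff N y k * a ^ k) % p

/-- **Arthur's challenge**: the number written in the first `B` bits of his move (`< 2^B < p`).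
[cite: AroraBarakCC2009, §8.3.3 ("picks a random value a ∈ 𝔽_p")] -/
def chal (N : ℕ) (a : List Bool) : ℕ := bitsToNat (a.take (bitsB N))

/-- **Merlin's prime**: the number written in the first `W` bits of his first move.
[cite: AroraBarakCC2009, §8.3.2 ("a prime p … the verifier can check that p is prime")] -/
def primeOf (N : ℕ) (y : List Bool) : ℕ := bitsToNat (y.take (widthW N))

/-- A challenge is below `2^B`. [folklore] -/
theorem chal_lt (N : ℕ) (a : List Bool) : chal N a < 2 ^ bitsB N :=
  (bitsToNat_lt _).trans_le (Nat.pow_le_pow_right (by norm_num) (List.length_take_le _ _))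

/-- A coefficient is below `2^W`. [folklore] -/
theorem coeff_lt (N : ℕ) (y : List Bool) (k : ℕ) : coeff N y k < 2 ^ widthW N :=
  (bitsToNat_lt _).trans_le (Nat.pow_le_pow_right (by norm_num) (by unfold block; exact List.length_take_le _ _))

/-- The prime candidate is below `2^W`. [folklore] -/
theorem primeOf_lt (N : ℕ) (y : List Bool) : primeOf N y < 2 ^ widthW N :=
  (bitsToNat_lt _).trans_le (Nat.pow_le_pow_right (by norm_num) (List.length_take_le _ _))

/-! ### The consistency test and the arithmetization, mod `p` on `ℕ` -/

/-- **The test value**, mod `p`, of an operator on Merlin's `s(0), s(1) < p` (and the current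
value `t < p` of its variable): for a quantifier (`isQ`), `s(0)·s(1)` if universal (`q`) and
`s(0) + s(1) - s(0)s(1)` if existential; for a linearisation, `(1 - t)s(0) + t·s(1) =
s(0) + t (s(1) - s(0))` — written with `%` and truncated subtraction so that a string machine
computes it literally. [cite: AroraBarakCC2009, §8.3.3 (Cases 1–3)] -/
def testVal (p : ℕ) (isQ q : Bool) (t s0 s1 : ℕ) : ℕ :=
  if isQ then (if q then (s0 * s1) % p else (s0 + s1 + (p - (s0 * s1) % p)) % p)
  else (s0 + t * ((s1 + (p - s0)) % p)) % p

/-- **The arithmetization `P_φ(ρ) mod p`** on `ℕ` (`ρ` a list of residues, read with default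
`0`; `¬ ↦ 1 - ·`, `∧ ↦ ·`, `∨ ↦ a + b - ab`, all reduced mod `p`). [cite: AroraBarakCC2009, §8.3.1] -/
def arithNat (p : ℕ) (rho : List ℕ) : PropForm ℕ → ℕ
  | .var i => rho.getD i 0 % p
  | .const b => (if b then 1 else 0) % p
  | .neg φ => (1 + (p - arithNat p rho φ)) % p
  | .conj φ ψ => (arithNat p rho φ * arithNat p rho ψ) % p
  | .disj φ ψ => (arithNat p rho φ + arithNat p rho ψ + (p - (arithNat p rho φ * arithNat p rho ψ) % p)) % p

/-! ### The referee's round loop -/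

/-- **State of the referee** between rounds: the unread moves, the block index `i` (variable of
the current quantifier) and offset `t` in the block (`t = 0`: the quantifier `Q_{X_i}`;
`t = k + 1`: the linearisation `L_{X_k}`), the point `ρ`, the claim `c`, and the flag "all
checks passed so far". [cite: AroraBarakCC2009, §8.3.3] -/
structure St where
  /-- the moves not yet read -/
  moves : List (List Bool)
  /-- index of the current quantifier block -/
  i : ℕ
  /-- offset in the block (`0` = the quantifier, `k+1` = `L_{X_k}`) -/
  t : ℕ
  /-- the current point `ρ` (residues mod `p`) -/
  rho : List ℕ
  /-- the current claim -/
  c : ℕ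
  /-- all consistency checks passed so far -/
  ok : Bool

/-- **One round**: while a quantifier block remains (`i < n`), read Merlin's polynomial `y` and
Arthur's reply `a`, check the operator's test against the claim, move the operator's variable to
the challenge and the claim to `s(challenge)`, and advance `(i, t)`; otherwise do nothing.
[cite: AroraBarakCC2009, §8.3.3 (Cases 1–3)] -/
def step (N p n : ℕ) (quants : List Bool) (S : St) : St :=
  if S.i < n then
    { moves := S.moves.drop 2
      i := if S.t < n then S.i else S.i + 1
      t := if S.t < n then S.t + 1 else 0
      rho := S.rho.set (if S.t = 0 then S.i else S.t - 1) (chal N ((S.moves.drop 1).headD []))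
      c := pv N p (S.moves.headD []) (chal N ((S.moves.drop 1).headD []))
      ok := S.ok && (testVal p (S.t == 0) (quants.getD S.i false)
        (S.rho.getD (if S.t = 0 then S.i else S.t - 1) 0)
        (pv N p (S.moves.headD []) 0) (pv N p (S.moves.headD []) 1) == S.c) }
  else S

/-- **The initial state**: the moves after the three opening ones (`a₀`, the prime move `y₀`,
`a₂`), block `0`, offset `0`, `ρ = 0`, claim `1` ("the formula is true"), flag set.
[cite: AroraBarakCC2009, §8.3.3] -/
def initSt (n : ℕ) (h : List (List Bool)) : St :=
  ⟨h.drop 3, 0, 0, List.replicate n 0, 1, true⟩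

/-- `R` rounds of the referee. [cite: AroraBarakCC2009, §8.3.3] -/
def run (N p n : ℕ) (quants : List Bool) (R : ℕ) (h : List (List Bool)) : St :=
  (step N p n quants)^[R] (initSt n h)

/-- The number of rounds the referee's loop is clocked for: `(N + 1)²  ≥ n(n+1)` (rounds beyond
the `n(n+1)` operators do nothing). [folklore] -/
def numRounds (N : ℕ) : ℕ := (N + 1) ^ 2

/-- **The referee's verdict** on the formula `quants, φ` (code length `N`) and the moves `h`:
Merlin's prime is a prime in `(2^B, 2^W)`, every consistency check passed, and the final claim
is the arithmetization at the final point. [cite: AroraBarakCC2009, §8.3.3] [cite: Shamir1992] -/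
def Accepts (quants : List Bool) (φ : PropForm ℕ) (N : ℕ) (h : List (List Bool)) : Prop :=
  (primeOf N (h.getD 1 [])).Prime ∧ 2 ^ bitsB N < primeOf N (h.getD 1 []) ∧
    (run N (primeOf N (h.getD 1 [])) quants.length quants (numRounds N) h).ok = true ∧
    arithNat (primeOf N (h.getD 1 [])) (run N (primeOf N (h.getD 1 [])) quants.length quants (numRounds N) h).rho φ =
      (run N (primeOf N (h.getD 1 [])) quants.length quants (numRounds N) h).c

/-- The verdict is decidable (it is computed by the referee). [folklore] -/
instance decidableAccepts (quants : List Bool) (φ : PropForm ℕ) (N : ℕ) (h : List (List Bool)) :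
    Decidable (Accepts quants φ N h) :=
  inferInstanceAs (Decidable (_ ∧ _))

/-! ### Unfolding the loop -/

/-- A round past the last block does nothing. [folklore] -/
theorem step_of_le {N p n : ℕ} {quants : List Bool} {S : St} (h : n ≤ S.i) : step N p n quants S = S := by
  unfold step; rw [if_neg (not_lt.2 h)]

/-- Rounds past the last block do nothing. [folklore] -/
theorem step_iterate_of_le {N p n : ℕ} {quants : List Bool} {S : St} (h : n ≤ S.i) (k : ℕ) :
    (step N p n quants)^[k] S = S :=
  Function.iterate_fixed (step_of_le h) k

/-- `run 0` is the initial state. [folklore] -/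
@[simp] theorem run_zero (N p n : ℕ) (quants : List Bool) (h : List (List Bool)) :
    run N p n quants 0 h = initSt n h := rfl

/-- One more round. [folklore] -/
theorem run_succ (N p n : ℕ) (quants : List Bool) (R : ℕ) (h : List (List Bool)) :
    run N p n quants (R + 1) h = step N p n quants (run N p n quants R h) := by
  rw [run, Function.iterate_succ_apply']; rfl

end Shamir

end Literature.Computability.Complexity
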